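import Summits.NavierStokesRegularity.NavierStokesRegularity.Theorems.ScenarioCensusPitchDefectGauge
import Summits.NavierStokesRegularity.NavierStokesRegularity.Theorems.SymmetryModuliCountHelicalEndLiouville
import Summits.NavierStokesRegularity.NavierStokesRegularity.Theorems.ScenarioCensusAncientAnnex
import HarnessLib.Audit
import HarnessLib

/-!
# Blow-up scenario census — rows A13 and A8t are EXCLUDED-IN-TREE: the periodic Oseen gauge

Cell `pub/ns-census` (`SCENARIO-CENSUS.md` v1.27+, seat ns-census-lead g4; landing assignment 10:21Z).
This file LANDS the refuter's probe P29 (ns-census-ref g4, `HOME/ns-census-ref/P29.lean`, sha16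
35ecac2094205094, 10:02Z: "rows A13 + A8t close from the tree") as census theorems; the mathematics and
the Lean text are the ref's (steps 0–3, 5–9 of `periodicGauge` are VERBATIM the corresponding steps of
typer-2 g5's `PitchDefect.helicalGauge`, p622138, with the helical transfer replaced by the trivial
transfer of `z`-periodicity, which commutes with the moving Galilean frame); typer-1 g4 only re-homes it
(namespace `…Theorems.ScenarioCensus[.PeriodicGauge]`, census names `row_A13_excluded` /
`row_A8t_excluded`).  CONED file (imports `Theorems.SymmetryModuliCountHelicalEndLiouville`, crux
⟨14062⟩ of route SymmetryModuliCount, and `ScenarioCensusPitchDefectGauge`); the rows themselves stay in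
the cone-free `ScenarioCensusAncientAnnex.lean` / `ScenarioCensusAncientSymmetry.lean`.

* `PeriodicGauge.periodic_transfer` — `z`-periodicity passes through an a.e. Galilean representation
  (`PitchDefect.helical_transfer` at one full turn).
* `PeriodicGauge.periodicGauge` — a `P`-periodic ancient mild solution (duality form, measurable slices)
  with the time-Type-I rate is, after a time shift, slice-wise a.e. `x ↦ V(τ, x − A(τ)) + c(τ)` for a
  GENUINE `V ∈ IsTypeIAncientMild (2C)` whose slices are `P`-periodic (Oseen gauge + momentum + `c_∞`
  boost).
* `PeriodicGauge.periodic_typeI_liouville_genuine` — the genuine-class periodic Type-I Liouville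
  theorem ALREADY IN THE TREE: composition of the landed stubs of crux `HelicalEndLiouville`
  (⟨14062⟩, line «vanishing-cell-reynolds»: `stub_cellGaps`, `stub_cellOscSlice`, `stub_cellOscRepr`,
  `stub_cellAbsorption`, `stub_lineLiouvilleEnd`, `stub_forwardVanishing`).
* **`row_A13_excluded : Row_A13`** (periodic × time-Type-I × duality class ⇒ a.e.-constant slices) and
  **`row_A8t_excluded : Row_A8t`** (helical × time-Type-I, via the landed glue `row_A8t_of_row_A13`).

Census effect (lead's words rule, ref CHECK on ACCEPT): rows A13 and A8t → EXCLUDED-IN-TREE; rows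
A8th / A8 (no rate) stay OPEN.  No summit statement is proved here; nothing in this file is a claim
about NS regularity beyond the displayed Liouville statements.
-/

set_option linter.dupNamespace false

noncomputable section

open MeasureTheory Set Function Filter Metric
open scoped Topology ENNReal NNReal

-- the summit and its single problem share the name `NavierStokesRegularity` (D-0017 nested layout)
namespace Summit.NavierStokesRegularity.NavierStokesRegularity.Theorems.ScenarioCensus

open Literature.Analysis Literature.Analysis.FluidPDE
open Summit.NavierStokesRegularity.NavierStokesRegularity.Theorems
open Summit.NavierStokesRegularity.NavierStokesRegularity.Theorems.ScenarioCensus.PitchDefect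

namespace PeriodicGauge

/-- Transfer of `z`-periodicity through an a.e. Galilean representation: `helical_transfer` at one
full turn `θ = 2π` (`rotZ (2π) = id`).  (Ref probe P29.) [folklore] -/
theorem periodic_transfer {w F : EuclideanSpace ℝ (Fin 3) → EuclideanSpace ℝ (Fin 3)}
    {P : ℝ} {a c : EuclideanSpace ℝ (Fin 3)} (hF : Continuous F)
    (hper : ∀ x, w (x + P • EuclideanSpace.single (2 : Fin 3) (1 : ℝ)) = w x)
    (hrep : w =ᵐ[volume] fun x => F (x - a) + c) :
    ∀ y, F (y + P • EuclideanSpace.single (2 : Fin 3) (1 : ℝ)) = F y := by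
  have hhel : ∀ x, w (rotZ (2 * Real.pi) x +
      (P / (2 * Real.pi) * (2 * Real.pi)) • EuclideanSpace.single (2 : Fin 3) (1 : ℝ)) =
        rotZ (2 * Real.pi) (w x) := by
    intro x
    have hP : P / (2 * Real.pi) * (2 * Real.pi) = P := by
      field_simp
    rw [FluidPDE.rotZ_two_pi, FluidPDE.rotZ_two_pi, hP]
    exact hper x
  intro y
  have key := helical_transfer hF hhel hrep y
  have hP : P / (2 * Real.pi) * (2 * Real.pi) = P := by field_simp
  rw [FluidPDE.rotZ_two_pi, FluidPDE.rotZ_two_pi, FluidPDE.rotZ_two_pi, FluidPDE.rotZ_two_pi,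
    sub_self, zero_add, sub_self, add_zero, hP] at key
  exact key

/-- **The periodic Oseen gauge** (periodic twin of typer-2 g5's `PitchDefect.helicalGauge`; ref probe
P29): a `P`-periodic ancient mild solution in the duality class with measurable slices and the time-Type-I
rate `‖u(t,x)‖ ≤ C/√(−t)` is, after the time shift by `t₁ < 0`, slice-wise a.e. equal to
`x ↦ V(τ, x − A(τ)) + c(τ)` with `V ∈ IsTypeIAncientMild (2C)` (KNSS/Oseen gauge), `A` continuous, and
every slice of `V` `P`-periodic. [cite: KochNadirashviliSereginSverak2009, §4 (Oseen gauge) and Lemma 3.1 (arXiv:0709.3599)] -/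
theorem periodicGauge {P C : ℝ}
    {u : ℝ → EuclideanSpace ℝ (Fin 3) → EuclideanSpace ℝ (Fin 3)}
    (hu : IsAncientMildSolution 1 u) (hmeas : ∀ t < 0, AEStronglyMeasurable (u t) volume)
    (hperu : ∀ t < 0, ∀ x : EuclideanSpace ℝ (Fin 3),
      u t (x + P • EuclideanSpace.single 2 (1 : ℝ)) = u t x)
    (hC : HasTypeITimeDecay C u) {t₁ : ℝ} (ht₁ : t₁ < 0) :
    ∃ (V : ℝ → EuclideanSpace ℝ (Fin 3) → EuclideanSpace ℝ (Fin 3))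
      (A c : ℝ → EuclideanSpace ℝ (Fin 3)),
      IsTypeIAncientMild (2 * C) V ∧ Continuous A ∧
      (∀ τ < 0, ∀ y : EuclideanSpace ℝ (Fin 3),
        V τ (y + P • EuclideanSpace.single 2 (1 : ℝ)) = V τ y) ∧
      ∀ τ < 0, u (τ + t₁) =ᵐ[volume] fun x => V τ (x - A τ) + c τ := by
  -- ## Step 0: the bounded shifted solution `w`
  have hsq₁ : 0 < Real.sqrt (-t₁) := Real.sqrt_pos.2 (by linarith)
  have hC0 : 0 ≤ C := by
    have h0 := (norm_nonneg _).trans (hC t₁ ht₁ 0)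
    rwa [le_div_iff₀ hsq₁, zero_mul] at h0
  set w : ℝ → EuclideanSpace ℝ (Fin 3) → EuclideanSpace ℝ (Fin 3) := fun τ => u (τ + t₁) with hw_def
  have hwC : ∀ τ < 0, ∀ x, ‖w τ x‖ ≤ C / Real.sqrt (-τ) := by
    intro τ hτ x
    have h1 := hC (τ + t₁) (by linarith) x
    have h2 : Real.sqrt (-τ) ≤ Real.sqrt (-(τ + t₁)) := Real.sqrt_le_sqrt (by linarith)
    exact h1.trans (div_le_div_of_nonneg_left hC0 (Real.sqrt_pos.2 (by linarith)) h2)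
  have hw : IsBoundedAncientMildSolution 1 w := by
    refine ⟨hu.time_translate ht₁.le, C / Real.sqrt (-t₁), fun τ hτ x => ?_⟩
    have hτ' : τ < 0 := mem_Iio.1 hτ
    have h1 := hC (τ + t₁) (by linarith) x
    have h2 : Real.sqrt (-t₁) ≤ Real.sqrt (-(τ + t₁)) := Real.sqrt_le_sqrt (by linarith)
    exact h1.trans (div_le_div_of_nonneg_left hC0 hsq₁ h2)
  have hwmeas : ∀ τ < 0, AEStronglyMeasurable (w τ) volume := fun τ hτ => hmeas (τ + t₁) (by linarith)
  have hwper : ∀ τ < 0, ∀ x : EuclideanSpace ℝ (Fin 3),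
      w τ (x + P • EuclideanSpace.single 2 (1 : ℝ)) = w τ x :=
    fun τ hτ x => hperu (τ + t₁) (by linarith) x
  -- ## Step 1: the Oseen gauge of `w`
  obtain ⟨v, A, c, hvm, hvc, ⟨K, hK⟩, hvdiv, hvmild, hAc, hrep⟩ :=
    oseen_gauge_of_aestronglyMeasurable w hw hwmeas
  have hvslice : ∀ τ < 0, Continuous (v τ) := fun τ hτ =>
    hvc.comp_continuous (Continuous.prodMk_right τ) fun y => ⟨hτ, mem_univ y⟩
  have hK0 : 0 ≤ K := (norm_nonneg _).trans (hK (-1) (by norm_num) 0)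
  -- ## Step 2: conservation of momentum for `v`
  have hmom : ∀ s t : ℝ, s < t → t < 0 →
      Tendsto (fun R : ℝ => ⨍ y in ball (0 : EuclideanSpace ℝ (Fin 3)) R, (v t y - v s y))
        atTop (𝓝 0) := fun s t hst ht => tendsto_setAverage_sub_of_oseenMild hvm hK hvmild hst ht
  -- ## Step 3': periodicity of the slices of `v` (translations commute with the frame)
  have hvper : ∀ τ < 0, ∀ y : EuclideanSpace ℝ (Fin 3),
      v τ (y + P • EuclideanSpace.single 2 (1 : ℝ)) = v τ y :=
    fun τ hτ => periodic_transfer (hvslice τ hτ) (hwper τ hτ) (hrep τ hτ)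
  -- ## Step 5: `‖v τ y + c τ‖ ≤ C/√(-τ)`
  have hprox : ∀ τ < 0, ∀ y, ‖v τ y + c τ‖ ≤ C / Real.sqrt (-τ) := by
    intro τ hτ y
    have hW : Continuous fun x => v τ (x - A τ) + c τ :=
      ((hvslice τ hτ).comp (continuous_id.sub continuous_const)).add continuous_const
    have key := TypeIliouvilleL.GaugeEverySlice.norm_le_of_ae_eq hW (hwC τ hτ) (hrep τ hτ) (y + A τ)
    simpa only [add_sub_cancel_right] using key
  -- ## Step 6: `‖c τ - c σ‖ ≤ C/√(-τ) + C/√(-σ)`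
  have hcdist : ∀ σ τ : ℝ, σ < 0 → τ < 0 →
      ‖c τ - c σ‖ ≤ C / Real.sqrt (-τ) + C / Real.sqrt (-σ) := by
    have hav : ∀ τ < 0, ∀ R : ℝ, 0 < R →
        ‖(⨍ y in ball (0 : EuclideanSpace ℝ (Fin 3)) R, v τ y) - (-c τ)‖ ≤ C / Real.sqrt (-τ) :=
      fun τ hτ R hR => TypeIliouvilleL.GaugeEverySlice.norm_setAverage_ball_sub_le
        (hvslice τ hτ).aestronglyMeasurable (fun y => by rw [sub_neg_eq_add]; exact hprox τ hτ y) hR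
    have hgen : ∀ σ τ : ℝ, σ < τ → τ < 0 →
        ‖c τ - c σ‖ ≤ C / Real.sqrt (-τ) + C / Real.sqrt (-σ) := by
      intro σ τ hστ hτ
      have hσ : σ < 0 := hστ.trans hτ
      have hb : ∀ᶠ R : ℝ in atTop,
          ‖(⨍ y in ball (0 : EuclideanSpace ℝ (Fin 3)) R, (v τ y - v σ y)) - (c σ - c τ)‖ ≤
            C / Real.sqrt (-τ) + C / Real.sqrt (-σ) := by
        filter_upwards [eventually_gt_atTop 0] with R hR
        have hfi : IntegrableOn (v τ) (ball (0 : EuclideanSpace ℝ (Fin 3)) R) volume :=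
          integrableOn_ball_of_norm_le (hvslice τ hτ).aestronglyMeasurable (hK τ hτ) 0 R
        have hgi : IntegrableOn (v σ) (ball (0 : EuclideanSpace ℝ (Fin 3)) R) volume :=
          integrableOn_ball_of_norm_le (hvslice σ hσ).aestronglyMeasurable (hK σ hσ) 0 R
        have hsub : (⨍ y in ball (0 : EuclideanSpace ℝ (Fin 3)) R, (v τ y - v σ y)) =
            (⨍ y in ball (0 : EuclideanSpace ℝ (Fin 3)) R, v τ y) -
              ⨍ y in ball (0 : EuclideanSpace ℝ (Fin 3)) R, v σ y := by
          rw [setAverage_eq, setAverage_eq, setAverage_eq, integral_sub hfi hgi, smul_sub]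
        rw [hsub]
        calc ‖(⨍ y in ball (0 : EuclideanSpace ℝ (Fin 3)) R, v τ y) -
              (⨍ y in ball (0 : EuclideanSpace ℝ (Fin 3)) R, v σ y) - (c σ - c τ)‖
            = ‖((⨍ y in ball (0 : EuclideanSpace ℝ (Fin 3)) R, v τ y) - (-c τ)) -
                ((⨍ y in ball (0 : EuclideanSpace ℝ (Fin 3)) R, v σ y) - (-c σ))‖ := by
              congr 1; abel
          _ ≤ ‖(⨍ y in ball (0 : EuclideanSpace ℝ (Fin 3)) R, v τ y) - (-c τ)‖ +
                ‖(⨍ y in ball (0 : EuclideanSpace ℝ (Fin 3)) R, v σ y) - (-c σ)‖ := norm_sub_le _ _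
          _ ≤ C / Real.sqrt (-τ) + C / Real.sqrt (-σ) := add_le_add (hav τ hτ R hR) (hav σ hσ R hR)
      have hlim : Tendsto (fun R : ℝ =>
          ‖(⨍ y in ball (0 : EuclideanSpace ℝ (Fin 3)) R, (v τ y - v σ y)) - (c σ - c τ)‖) atTop
          (𝓝 ‖(0 : EuclideanSpace ℝ (Fin 3)) - (c σ - c τ)‖) := ((hmom σ τ hστ hτ).sub_const _).norm
      have h := le_of_tendsto hlim hb
      rwa [zero_sub, norm_neg, norm_sub_rev] at h
    intro σ τ hσ hτ
    rcases lt_trichotomy σ τ with hστ | rfl | hτσ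
    · exact hgen σ τ hστ hτ
    · rw [sub_self, norm_zero]; positivity
    · rw [norm_sub_rev, add_comm]; exact hgen τ σ hτσ hσ
  -- ## Step 7: the limit `c∞` of `c` at `-∞`
  set cs : ℕ → EuclideanSpace ℝ (Fin 3) := fun n => c (-((n : ℝ) + 1)) with hcs_def
  have hcs_cauchy : CauchySeq cs := by
    refine cauchySeq_of_le_tendsto_0 (fun N : ℕ => 2 * C / Real.sqrt ((N : ℝ) + 1)) ?_ ?_
    · intro n m N hNn hNm
      rw [dist_eq_norm, hcs_def]
      have hn1 : (0 : ℝ) < (n : ℝ) + 1 := by positivity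
      have hm1 : (0 : ℝ) < (m : ℝ) + 1 := by positivity
      have hN1 : (0 : ℝ) < (N : ℝ) + 1 := by positivity
      have key := hcdist (-((m : ℝ) + 1)) (-((n : ℝ) + 1)) (by linarith) (by linarith)
      rw [neg_neg, neg_neg] at key
      have hNn0 : (N : ℝ) ≤ n := by exact_mod_cast hNn
      have hNm0 : (N : ℝ) ≤ m := by exact_mod_cast hNm
      have hNn' : Real.sqrt ((N : ℝ) + 1) ≤ Real.sqrt ((n : ℝ) + 1) :=
        Real.sqrt_le_sqrt (by linarith)
      have hNm' : Real.sqrt ((N : ℝ) + 1) ≤ Real.sqrt ((m : ℝ) + 1) :=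
        Real.sqrt_le_sqrt (by linarith)
      have hsN : 0 < Real.sqrt ((N : ℝ) + 1) := Real.sqrt_pos.2 hN1
      calc ‖c (-((n : ℝ) + 1)) - c (-((m : ℝ) + 1))‖
          ≤ C / Real.sqrt ((n : ℝ) + 1) + C / Real.sqrt ((m : ℝ) + 1) := key
        _ ≤ C / Real.sqrt ((N : ℝ) + 1) + C / Real.sqrt ((N : ℝ) + 1) :=
            add_le_add (div_le_div_of_nonneg_left hC0 hsN hNn')
              (div_le_div_of_nonneg_left hC0 hsN hNm')
        _ = 2 * C / Real.sqrt ((N : ℝ) + 1) := by ring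
    · have h1 : Tendsto (fun N : ℕ => Real.sqrt ((N : ℝ) + 1)) atTop atTop := by
        refine Real.tendsto_sqrt_atTop.comp ?_
        exact tendsto_atTop_add_const_right _ _ tendsto_natCast_atTop_atTop
      have h2 := h1.inv_tendsto_atTop.const_mul (2 * C)
      rw [mul_zero] at h2
      refine h2.congr fun N => ?_
      simp only [Pi.inv_apply, div_eq_mul_inv]
  obtain ⟨cinf, hcinf⟩ := cauchySeq_tendsto_of_complete hcs_cauchy
  -- `‖c τ - c∞‖ ≤ C/√(-τ)`
  have hcinf_dist : ∀ τ < 0, ‖c τ - cinf‖ ≤ C / Real.sqrt (-τ) := by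
    intro τ hτ
    have hlim : Tendsto (fun n : ℕ => ‖c τ - cs n‖) atTop (𝓝 ‖c τ - cinf‖) :=
      (tendsto_const_nhds.sub hcinf).norm
    have hbd : Tendsto (fun n : ℕ => C / Real.sqrt (-τ) + C / Real.sqrt ((n : ℝ) + 1)) atTop
        (𝓝 (C / Real.sqrt (-τ) + 0)) := by
      have h1 : Tendsto (fun N : ℕ => Real.sqrt ((N : ℝ) + 1)) atTop atTop := by
        refine Real.tendsto_sqrt_atTop.comp ?_
        exact tendsto_atTop_add_const_right _ _ tendsto_natCast_atTop_atTop
      have h2 := h1.inv_tendsto_atTop.const_mul C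
      rw [mul_zero] at h2
      refine tendsto_const_nhds.add (h2.congr fun N => ?_)
      simp only [Pi.inv_apply, div_eq_mul_inv]
    rw [add_zero] at hbd
    refine le_of_tendsto_of_tendsto' hlim hbd fun n => ?_
    have key := hcdist (-((n : ℝ) + 1)) τ (by have : (0:ℝ) ≤ n := n.cast_nonneg; linarith) hτ
    rwa [neg_neg] at key
  -- `‖v τ y + c∞‖ ≤ 2C/√(-τ)`
  have hprox2 : ∀ τ < 0, ∀ y, ‖v τ y + cinf‖ ≤ 2 * C / Real.sqrt (-τ) := by
    intro τ hτ y
    calc ‖v τ y + cinf‖ = ‖(v τ y + c τ) - (c τ - cinf)‖ := by congr 1; abel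
      _ ≤ ‖v τ y + c τ‖ + ‖c τ - cinf‖ := norm_sub_le _ _
      _ ≤ C / Real.sqrt (-τ) + C / Real.sqrt (-τ) := add_le_add (hprox τ hτ y) (hcinf_dist τ hτ)
      _ = 2 * C / Real.sqrt (-τ) := by ring
  -- ## Step 8: the Galilean boost by the constant `c∞`
  set U : ℝ → EuclideanSpace ℝ (Fin 3) → EuclideanSpace ℝ (Fin 3) := fun τ y => v τ y + cinf
    with hU_def
  set b : ℝ → EuclideanSpace ℝ (Fin 3) := fun _ => -cinf with hb_def
  have hUm : Measurable (uncurry U) := by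
    have : uncurry U = fun p : ℝ × EuclideanSpace ℝ (Fin 3) => uncurry v p + cinf := by
      funext p; rfl
    rw [this]
    exact hvm.add_const cinf
  have hbm : Measurable b := measurable_const
  have hUc : ContinuousOn (uncurry U) (Iio 0 ×ˢ univ) := by
    have : uncurry U = fun p : ℝ × EuclideanSpace ℝ (Fin 3) => uncurry v p + cinf := by
      funext p; rfl
    rw [this]
    exact hvc.add continuousOn_const
  have hloc : ∀ T : ℝ, T < 0 → ∃ N : ℝ,
      (∀ t ∈ Ioo T 0, ∀ x, ‖U t x‖ ≤ N) ∧ ∀ t ∈ Ioo T 0, ‖b t‖ ≤ N := by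
    intro T _
    refine ⟨K + ‖cinf‖, fun t ht x => ?_, fun t _ => ?_⟩
    · calc ‖U t x‖ = ‖v t x + cinf‖ := rfl
        _ ≤ ‖v t x‖ + ‖cinf‖ := norm_add_le _ _
        _ ≤ K + ‖cinf‖ := by gcongr; exact hK t ht.2 x
    · show ‖-cinf‖ ≤ K + ‖cinf‖
      rw [norm_neg]; linarith
  have hUdiv : ∀ t < 0, IsWeaklyDivFree (U t) := fun t ht => (hvdiv t ht).add_const cinf
  have hUmild : ∀ s t : ℝ, s < t → t < 0 → ∀ x,
      U t x = UnboundedOperators.heatExtension (U s) (t - s) x - driftDuhamel U b s t x := by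
    intro s t hst ht x
    have hT : driftTensor U b = driftTensor v 0 := by
      funext σ j k y
      simp only [driftTensor_apply, hU_def, hb_def, add_neg_cancel_right, Pi.zero_apply, add_zero]
    have hD : driftDuhamel U b s t x = oseenDuhamel 1 s v v t x := by
      have h1 : driftDuhamel U b s t x = driftDuhamel v 0 s t x := by
        rw [driftDuhamel_apply, driftDuhamel_apply, hT]
      rw [h1]
      exact driftDuhamel_zero_eq_oseenDuhamel finrank_euclideanSpace_fin
        (fun σ hσ => (hvslice σ (hσ.2.trans ht)).measurable)
        (fun σ hσ y => hK σ (hσ.2.trans ht) y) hst.le x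
    have hH : UnboundedOperators.heatExtension (U s) (t - s) x =
        UnboundedOperators.heatExtension (v s) (t - s) x + cinf :=
      heatExtension_add_const_apply (hvslice s (hst.trans ht)).aestronglyMeasurable
        (hK s (hst.trans ht)) cinf (sub_pos.2 hst) x
    rw [hD, hH]
    show v t x + cinf = _
    rw [hvmild s t hst ht x]
    abel
  obtain ⟨A₂, hA₂c, hVm, hVc, hVmild⟩ := stub_driftMild_ancient_oseen U b hUm hbm hUc hloc hUdiv hUmild
  -- ## Step 9: the genuine field `V`, its class, its periodicity and the representation
  set V : ℝ → EuclideanSpace ℝ (Fin 3) → EuclideanSpace ℝ (Fin 3) := fun t y => U t (y + A₂ t)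
    with hV_def
  have hVdiv : ∀ t < 0, IsWeaklyDivFree (V t) := fun t ht => (hUdiv t ht).comp_add_right' (A₂ t)
  have hVrate : HasTypeITimeDecay (2 * C) V := fun t ht y => hprox2 t ht (y + A₂ t)
  have hVmild' : ∀ s t : ℝ, s < t → t < 0 → ∀ y,
      V t y = UnboundedOperators.heatExtension (V s) (t - s) y - oseenDuhamel 1 s V V t y :=
    fun s t hst ht y => hVmild s t hst ht y
  have hVclass : IsTypeIAncientMild (2 * C) V :=
    LocalTypeIBlowup.isTypeIAncientMild_of_continuous_oseenMild_rate hVc hVdiv hVmild' hVrate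
  set A' : ℝ → EuclideanSpace ℝ (Fin 3) := fun τ => A τ + A₂ τ with hA'_def
  have hrep' : ∀ τ < 0, w τ =ᵐ[volume] fun x => V τ (x - A' τ) + (c τ - cinf) := by
    intro τ hτ
    filter_upwards [hrep τ hτ] with x hx
    rw [hx]
    simp only [hV_def, hU_def, hA'_def]
    rw [show x - (A τ + A₂ τ) + A₂ τ = x - A τ by abel]
    abel
  refine ⟨V, A', fun τ => c τ - cinf, hVclass, hAc.add hA₂c, fun τ hτ y => ?_, fun τ hτ => ?_⟩
  · -- periodicity of the slice `V τ`
    simp only [hV_def, hU_def]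
    rw [show y + P • EuclideanSpace.single 2 (1 : ℝ) + A₂ τ =
      (y + A₂ τ) + P • EuclideanSpace.single 2 (1 : ℝ) by abel, hvper τ hτ]
  · -- the representation of `u (τ + t₁) = w τ`
    have e : u (τ + t₁) = w τ := rfl
    rw [e]
    exact hrep' τ hτ

/-- Genuine-class periodic Type-I ancient Liouville, composed from the LANDED stubs of crux ⟨14062⟩
`HelicalEndLiouville` (line «vanishing-cell-reynolds»; ref probe P28/P29): a KNSS-gauge Type-I ancient
mild field periodic under a nonzero translation `L` vanishes identically.
[cite: KochNadirashviliSereginSverak2009, Thm 5.1 and §4 (arXiv:0709.3599)] -/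
theorem periodic_typeI_liouville_genuine
    (C : ℝ) (u : ℝ → EuclideanSpace ℝ (Fin 3) → EuclideanSpace ℝ (Fin 3))
    (hu : IsTypeIAncientMild C u) (L : EuclideanSpace ℝ (Fin 3)) (hL0 : L ≠ 0)
    (hper : ∀ t < 0, ∀ x, u t (x + L) = u t x) : ∀ t < 0, ∀ x, u t x = 0 := by
  obtain ⟨κ, _hκ, hheat, hoseen⟩ := stub_cellGaps
  obtain ⟨K, _hK, hslice⟩ := stub_cellOscSlice κ hoseen
  have hext := stub_cellAbsorption κ K hheat stub_cellOscRepr hslice C u hu L 0 hL0 le_rfl hper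
  set T : ℝ := min 0 (-(8 * K * C * ‖L‖) ^ 2) with hT
  have hT0 : T ≤ 0 := min_le_left _ _
  have hinv : ∀ τ < T, ∀ (y : EuclideanSpace ℝ (Fin 3)) (s : ℝ), u τ (y + s • L) = u τ y :=
    fun τ hτ y s => hext τ (lt_of_lt_of_le hτ hT0) (lt_of_lt_of_le hτ (min_le_right _ _)) y s
  have hzero : ∀ τ < T, ∀ y, u τ y = 0 := stub_lineLiouvilleEnd C u hu L T hL0 hT0 hinv
  exact stub_forwardVanishing C u hu T hT0 hzero

end PeriodicGauge

/-- **Row A13 is a theorem of the tree** (`P`-periodic × time-Type-I × duality class ⇒ a.e.-constant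
slices): the periodic Oseen gauge `PeriodicGauge.periodicGauge` + the genuine-class periodic Type-I
Liouville theorem `PeriodicGauge.periodic_typeI_liouville_genuine` (crux ⟨14062⟩ stubs, landed).  Ref
probe P29 (ns-census-ref g4), landed by typer-1 g4.  Cell A13: EXCLUDED-IN-TREE.
[cite: KochNadirashviliSereginSverak2009, §1 conjecture (L) and Thm 5.1 (arXiv:0709.3599)] -/
theorem row_A13_excluded : Row_A13 := by
  intro P hP u hu hmeas hper hdec t ht
  obtain ⟨C, hC⟩ := hdec
  have ht2 : t / 2 < 0 := by linarith
  obtain ⟨V, A, c, hV, -, hVper, hrep⟩ :=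
    PeriodicGauge.periodicGauge (t₁ := t / 2) hu hmeas (fun s hs x => hper s hs x) hC ht2
  have hL0 : P • EuclideanSpace.single (2 : Fin 3) (1 : ℝ) ≠ 0 := by
    refine smul_ne_zero hP.ne' fun h0 => ?_
    have h1 := congrArg (fun v : EuclideanSpace ℝ (Fin 3) => v 2) h0
    simp at h1
  have hV0 : ∀ τ < 0, ∀ y, V τ y = 0 :=
    PeriodicGauge.periodic_typeI_liouville_genuine (2 * C) V hV _ hL0 hVper
  refine ⟨c (t / 2), ?_⟩
  have key := hrep (t / 2) ht2
  rw [show t / 2 + t / 2 = t by ring] at key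
  filter_upwards [key] with x hx
  rw [hx, hV0 (t / 2) ht2, zero_add]

/-- **Row A8t is a theorem of the tree** (HELICAL pitch `h ≠ 0` × time-Type-I × duality class ⇒
a.e.-constant slices): a helical slice is `2π|h|`-periodic (`row_A8t_of_row_A13`, landed glue) and row A13
is excluded.  Ref probe P29, landed by typer-1 g4.  Cell A8t: EXCLUDED-IN-TREE (rows A8th / A8, no
rate, stay OPEN). [cite: KochNadirashviliSereginSverak2009, §1 conjecture (L) and Thm 5.1 (arXiv:0709.3599)] -/
theorem row_A8t_excluded : Row_A8t := row_A8t_of_row_A13 row_A13_excluded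

/-- Row A7c re-derived through A13 (sanity of the lattice; A7c was already EXCLUDED-IN-TREE by
`row_A7c_excluded`). [folklore] -/
theorem row_A7c_of_row_A13_excluded : Row_A7c := row_A7c_of_row_A13 row_A13_excluded

end Summit.NavierStokesRegularity.NavierStokesRegularity.Theorems.ScenarioCensus

end
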